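import Summits.AtomisticToContinuum.FouriersLaw.Theorems.VanishingNoiseTransferNoisyFourierThomsonWitnessBlocks

/-!
# Costs of the Thomson witness, Liouvillian part, I: pointwise bounds by a local size
(`--supports` file for crux `VanishingNoiseTransfer.NoisyFourier`, stmt-AtomisticToContinuum-11977, line
`abel-storage-decay`, stub B `stub_bulkAbelGKPositivity`; part W5b "WitnessL2Liouvillian" of lead c7's
Thomson-witness project, file 1 of 3)

Setting: the pinned anharmonic chain `P = pinnedChain ω₂ lam β γ` on `L` sites, `H_k = ∂_{q_k} H`,
`H_kk = ∂_{q_k}∂_{q_k} H`, bond `(i, j = i + 1)`, `r = q_j − q_i`, `φ(r) = 1/(1 + 3βr²)`,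
`φ' = −6βr/(1 + 3βr²)²`, `φ'' = 6β(9βr² − 1)/(1 + 3βr²)³`. The Liouvillian of the Thomson witness is
`X v = (p_0² − p_{L−1}²) + Σ_bonds (p_i R_A + p_j R_B)` (part W3) with
`R_A = p_j (p_j² φ'' − H_jj φ − 3 H_j φ') + (Σ_{k = j+1} p_k V''(q_k − q_j)) φ`,
`R_B = p_i (−p_i² φ'' + H_ii φ − 3 H_i φ') − (Σ_{i = k+1} p_k V''(q_i − q_k)) φ`.
This file bounds these explicit expressions POINTWISE by powers of an abstract "local size" `m ≥ 1`
dominating the squares of the coordinates involved: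
* `phi_sq_le_one`, `dphi_sq_le`, `ddphi_sq_le` (+ `abs_…` forms): `φ² ≤ 1`, `φ'² ≤ 3β`, `φ''² ≤ (24β)²`;
* a small calculus of bounds `u² ≤ K m^a` (`sq_mul_le`, `sq_add_le`, `sq_sub_le`, `sq_lift`, `sq_sum_succ_le`, …);
* `partialQ_hamiltonian_sq_le` (`H_k² ≤ K m³`), `partialQ_partialQ_hamiltonian_sq_le` (`H_kk² ≤ K m²`),
  `bondRA_sq_le`, `bondRB_sq_le` (`R_A², R_B² ≤ K m⁴`) with constants depending on `ω₂, lam, β` only;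
* registered helper `helper_thomsonWitnessPhiBounds`.
All statements are [folklore]; no definitions; axioms `propext`, `Classical.choice`, `Quot.sound` only.
-/

noncomputable section

open scoped BigOperators
open Literature.MathematicalPhysics.KineticTheory.HeatConduction
open Summit.AtomisticToContinuum.FouriersLaw.Theorems.NoisyFourier.ThomsonWitness.Algebra
  (one_add_three_mul_sq_pos partialQ_hamiltonian_explicit partialQ_partialQ_hamiltonian hessPotential_diag)

namespace Summit.AtomisticToContinuum.FouriersLaw.Theorems.NoisyFourier.ThomsonWitness.Costs.Xv

variable {L : ℕ} {ω₂ lam β γ : ℝ}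

/-! ### Bounds on `φ`, `φ'`, `φ''` -/

/-- `φ(r)² ≤ 1` for `φ = 1/(1 + 3βr²)`, `β ≥ 0`. [folklore] -/
theorem phi_sq_le_one (hβ : 0 ≤ β) (r : ℝ) : (1 / (1 + 3 * β * r ^ 2)) ^ 2 ≤ 1 := by
  have hD : 1 ≤ 1 + 3 * β * r ^ 2 := by nlinarith [sq_nonneg r]
  have h1 : 1 / (1 + 3 * β * r ^ 2) ≤ 1 := (div_le_one (by linarith)).2 hD
  have h0 : 0 ≤ 1 / (1 + 3 * β * r ^ 2) := by positivity
  nlinarith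

/-- `|φ(r)| ≤ 1`. [folklore] -/
theorem abs_phi_le_one (hβ : 0 ≤ β) (r : ℝ) : |1 / (1 + 3 * β * r ^ 2)| ≤ 1 :=
  abs_le_of_sq_le_sq (by simpa using phi_sq_le_one hβ r) zero_le_one

/-- `φ'(r)² ≤ 3β` for `φ' = −6βr/(1 + 3βr²)²` (`2√(3β)|r| ≤ 1 + 3βr²`). [folklore] -/
theorem dphi_sq_le (hβ : 0 ≤ β) (r : ℝ) : (-(6 * β * r) / (1 + 3 * β * r ^ 2) ^ 2) ^ 2 ≤ 3 * β := by
  set u := β * r ^ 2 with hu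
  have hu0 : 0 ≤ u := by positivity
  have hD : 0 < 1 + 3 * β * r ^ 2 := one_add_three_mul_sq_pos hβ r
  have hD1 : 1 ≤ 1 + 3 * u := by linarith
  rw [div_pow, neg_sq, div_le_iff₀ (by positivity)]
  have h1 : 12 * u ≤ (1 + 3 * u) ^ 2 := by nlinarith [sq_nonneg (1 - 3 * u)]
  have h2 : (1 + 3 * u) ^ 2 ≤ (1 + 3 * u) ^ 4 := by
    have := pow_le_pow_right₀ hD1 (show 2 ≤ 4 by norm_num)
    exact this
  have h3 : (6 * β * r) ^ 2 = 3 * β * (12 * u) := by rw [hu]; ring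
  have h4 : ((1 + 3 * β * r ^ 2) ^ 2) ^ 2 = (1 + 3 * u) ^ 4 := by rw [hu]; ring
  rw [h3, h4]
  have h5 : 12 * u ≤ (1 + 3 * u) ^ 4 := h1.trans h2
  nlinarith

/-- `|φ'(r)| ≤ √(3β)`. [folklore] -/
theorem abs_dphi_le (hβ : 0 ≤ β) (r : ℝ) : |-(6 * β * r) / (1 + 3 * β * r ^ 2) ^ 2| ≤ Real.sqrt (3 * β) :=
  Real.abs_le_sqrt (dphi_sq_le hβ r)

/-- `φ''(r)² ≤ (24β)²` for `φ'' = 6β(9βr² − 1)/(1 + 3βr²)³`. [folklore] -/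
theorem ddphi_sq_le (hβ : 0 ≤ β) (r : ℝ) :
    (6 * β * (9 * β * r ^ 2 - 1) / (1 + 3 * β * r ^ 2) ^ 3) ^ 2 ≤ (24 * β) ^ 2 := by
  set u := β * r ^ 2 with hu
  have hu0 : 0 ≤ u := by positivity
  have hD1 : 1 ≤ 1 + 3 * u := by linarith
  rw [div_pow, div_le_iff₀ (by rw [hu] at *; positivity)]
  have h3 : (6 * β * (9 * β * r ^ 2 - 1)) ^ 2 = 36 * β ^ 2 * (9 * u - 1) ^ 2 := by rw [hu]; ring
  have h4 : ((1 + 3 * β * r ^ 2) ^ 3) ^ 2 = (1 + 3 * u) ^ 6 := by rw [hu]; ring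
  rw [h3, h4]
  have h5 : (9 * u - 1) ^ 2 ≤ 9 * (1 + 3 * u) ^ 2 := by nlinarith
  have h6 : (1 + 3 * u) ^ 2 ≤ (1 + 3 * u) ^ 6 := pow_le_pow_right₀ hD1 (by norm_num)
  nlinarith [sq_nonneg β]

/-- `|φ''(r)| ≤ 24β`. [folklore] -/
theorem abs_ddphi_le (hβ : 0 ≤ β) (r : ℝ) :
    |6 * β * (9 * β * r ^ 2 - 1) / (1 + 3 * β * r ^ 2) ^ 3| ≤ 24 * β :=
  abs_le_of_sq_le_sq (ddphi_sq_le hβ r) (by positivity)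

/-! ### A small calculus of bounds `u² ≤ K m^a` by a local size `m ≥ 1` -/

section Calculus

variable {u v Ku Kv K m : ℝ} {a b n : ℕ}

/-- The constant of a bound `u² ≤ K m^a`, `m ≥ 1`, is nonnegative. [folklore] -/
theorem coeff_nonneg (hu : u ^ 2 ≤ K * m ^ a) (hm : 1 ≤ m) : 0 ≤ K :=
  le_of_mul_le_mul_right (by rw [zero_mul]; exact (sq_nonneg u).trans hu) (pow_pos (by linarith) a)

/-- Raising the exponent: `u² ≤ K m^a ≤ K m^n` for `a ≤ n`, `m ≥ 1`. [folklore] -/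
theorem sq_lift (hu : u ^ 2 ≤ K * m ^ a) (hm : 1 ≤ m) (han : a ≤ n) : u ^ 2 ≤ K * m ^ n :=
  hu.trans (mul_le_mul_of_nonneg_left (pow_le_pow_right₀ hm han) (coeff_nonneg hu hm))

/-- Products: `(uv)² ≤ K_u K_v m^{a+b}`. [folklore] -/
theorem sq_mul_le (hu : u ^ 2 ≤ Ku * m ^ a) (hv : v ^ 2 ≤ Kv * m ^ b) :
    (u * v) ^ 2 ≤ (Ku * Kv) * m ^ (a + b) := by
  have h0 : 0 ≤ Ku * m ^ a := (sq_nonneg u).trans hu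
  calc (u * v) ^ 2 = u ^ 2 * v ^ 2 := mul_pow u v 2
    _ ≤ (Ku * m ^ a) * (Kv * m ^ b) := mul_le_mul hu hv (sq_nonneg v) h0
    _ = (Ku * Kv) * m ^ (a + b) := by rw [pow_add]; ring

/-- Sums: `(u + v)² ≤ 2(K_u + K_v) m^n`. [folklore] -/
theorem sq_add_le (hu : u ^ 2 ≤ Ku * m ^ a) (hv : v ^ 2 ≤ Kv * m ^ b) (hm : 1 ≤ m) (ha : a ≤ n) (hb : b ≤ n) :
    (u + v) ^ 2 ≤ (2 * (Ku + Kv)) * m ^ n := by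
  have hu' := sq_lift hu hm ha
  have hv' := sq_lift hv hm hb
  nlinarith [sq_nonneg (u - v)]

/-- Differences: `(u − v)² ≤ 2(K_u + K_v) m^n`. [folklore] -/
theorem sq_sub_le (hu : u ^ 2 ≤ Ku * m ^ a) (hv : v ^ 2 ≤ Kv * m ^ b) (hm : 1 ≤ m) (ha : a ≤ n) (hb : b ≤ n) :
    (u - v) ^ 2 ≤ (2 * (Ku + Kv)) * m ^ n := by
  have hu' := sq_lift hu hm ha
  have hv' := sq_lift hv hm hb
  nlinarith [sq_nonneg (u + v)]

/-- Negation. [folklore] -/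
theorem sq_neg_le (hu : u ^ 2 ≤ K * m ^ a) : (-u) ^ 2 ≤ K * m ^ a := by
  rwa [neg_sq]

/-- Constants: `c² ≤ c² m⁰`. [folklore] -/
theorem sq_const_le (c m : ℝ) : c ^ 2 ≤ c ^ 2 * m ^ 0 := by
  rw [pow_zero, mul_one]

/-- A bounded factor: `u² ≤ B` gives `u² ≤ B m⁰`. [folklore] -/
theorem sq_le_pow_zero {B : ℝ} (hu : u ^ 2 ≤ B) (m : ℝ) : u ^ 2 ≤ B * m ^ 0 := by
  rwa [pow_zero, mul_one]

/-- A coordinate: `c² ≤ m` gives `c² ≤ 1 · m¹`. [folklore] -/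
theorem sq_le_pow_one {c : ℝ} (hc : c ^ 2 ≤ m) : c ^ 2 ≤ 1 * m ^ 1 := by
  rwa [pow_one, one_mul]

/-- A squared coordinate: `c² ≤ m` gives `(c²)² ≤ 1 · m²`. [folklore] -/
theorem sq_sq_le {c : ℝ} (hc : c ^ 2 ≤ m) : (c ^ 2) ^ 2 ≤ 1 * m ^ 2 := by
  rw [one_mul]
  exact pow_le_pow_left₀ (sq_nonneg c) hc 2

/-- A cubed coordinate: `c² ≤ m` gives `(c³)² ≤ 1 · m³`. [folklore] -/
theorem cube_sq_le {c : ℝ} (hc : c ^ 2 ≤ m) : (c ^ 3) ^ 2 ≤ 1 * m ^ 3 := by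
  rw [one_mul, show (c ^ 3) ^ 2 = (c ^ 2) ^ 3 by ring]
  exact pow_le_pow_left₀ (sq_nonneg c) hc 3

/-- A difference of coordinates: `(c − d)² ≤ 4m`. [folklore] -/
theorem sub_sq_le {c d : ℝ} (hc : c ^ 2 ≤ m) (hd : d ^ 2 ≤ m) : (c - d) ^ 2 ≤ 4 * m ^ 1 := by
  nlinarith [sq_nonneg (c + d)]

/-- Its cube: `((c − d)³)² ≤ 64 m³`. [folklore] -/
theorem sub_cube_sq_le {c d : ℝ} (hc : c ^ 2 ≤ m) (hd : d ^ 2 ≤ m) : ((c - d) ^ 3) ^ 2 ≤ 64 * m ^ 3 := by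
  have h := pow_le_pow_left₀ (sq_nonneg (c - d)) (sub_sq_le hc hd) 3
  calc ((c - d) ^ 3) ^ 2 = ((c - d) ^ 2) ^ 3 := by ring
    _ ≤ (4 * m ^ 1) ^ 3 := h
    _ = 64 * m ^ 3 := by ring

/-- A sum guarded by `l = j + 1` has at most one term: if every admissible term satisfies `f_l² ≤ K m^a`
(`K ≥ 0`) then so does the sum. [folklore] -/
theorem sq_sum_succ_le {L : ℕ} (j : Fin L) {f : Fin L → ℝ} (hK : 0 ≤ K * m ^ a)
    (h : ∀ l : Fin L, l.val = j.val + 1 → f l ^ 2 ≤ K * m ^ a) :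
    (∑ l : Fin L, if l.val = j.val + 1 then f l else 0) ^ 2 ≤ K * m ^ a := by
  by_cases hj : j.val + 1 < L
  · rw [Finset.sum_eq_single (⟨j.val + 1, hj⟩ : Fin L), if_pos rfl]
    · exact h _ rfl
    · intro l _ hl
      rw [if_neg]
      intro e
      exact hl (Fin.ext e)
    · intro hh
      exact absurd (Finset.mem_univ _) hh
  · rw [Finset.sum_eq_zero]
    · simpa using hK
    · intro l _
      rw [if_neg]
      intro e
      exact hj (e ▸ l.isLt)

/-- A sum guarded by `j = l + 1` has at most one term: if every admissible term satisfies `f_l² ≤ K m^a`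
(`K ≥ 0`) then so does the sum. [folklore] -/
theorem sq_sum_pred_le {L : ℕ} (j : Fin L) {f : Fin L → ℝ} (hK : 0 ≤ K * m ^ a)
    (h : ∀ l : Fin L, j.val = l.val + 1 → f l ^ 2 ≤ K * m ^ a) :
    (∑ l : Fin L, if j.val = l.val + 1 then f l else 0) ^ 2 ≤ K * m ^ a := by
  by_cases hj : 1 ≤ j.val
  · rw [Finset.sum_eq_single (⟨j.val - 1, by omega⟩ : Fin L), if_pos (by simp only; omega)]
    · exact h _ (by simp only; omega)
    · intro l _ hl
      rw [if_neg]
      intro e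
      exact hl (Fin.ext (by simp only; omega))
    · intro hh
      exact absurd (Finset.mem_univ _) hh
  · rw [Finset.sum_eq_zero]
    · simpa using hK
    · intro l _
      rw [if_neg]
      omega

end Calculus

/-! ### The force `H_k` and the diagonal Hessian entry `H_kk` -/

/-- `V'(c − d)² ≤ K m³` for `V'(r) = r + βr³` when `c², d² ≤ m`, `m ≥ 1`. [folklore] -/
theorem derivV_sq_le {c d m : ℝ} (hm : 1 ≤ m) (hc : c ^ 2 ≤ m) (hd : d ^ 2 ≤ m) :
    ((c - d) + β * (c - d) ^ 3) ^ 2 ≤ (2 * (4 + β ^ 2 * 64)) * m ^ 3 :=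
  sq_add_le (sub_sq_le hc hd) (sq_mul_le (sq_const_le β m) (sub_cube_sq_le hc hd)) hm (by norm_num)
    (by norm_num)

/-- `V''(c − d)² ≤ K m²` for `V''(r) = 1 + 3βr²` when `c², d² ≤ m`, `m ≥ 1`. [folklore] -/
theorem dderivV_sq_le {c d m : ℝ} (hm : 1 ≤ m) (hc : c ^ 2 ≤ m) (hd : d ^ 2 ≤ m) :
    (1 + 3 * β * (c - d) ^ 2) ^ 2 ≤ (2 * (1 ^ 2 + (3 * β) ^ 2 * (1 * 16))) * m ^ 2 := by
  have h2 : ((c - d) ^ 2) ^ 2 ≤ (1 * 16) * m ^ 2 := by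
    have h := pow_le_pow_left₀ (sq_nonneg (c - d)) (sub_sq_le hc hd) 2
    calc ((c - d) ^ 2) ^ 2 ≤ (4 * m ^ 1) ^ 2 := h
      _ = (1 * 16) * m ^ 2 := by ring
  exact sq_add_le (sq_const_le 1 m) (sq_mul_le (sq_const_le (3 * β) m) h2) hm (by norm_num) (by norm_num)

/-- **The force is locally cubic**: `H_k² ≤ K m³` whenever `m ≥ 1` dominates `q_k²` and the squares of the
neighbouring positions, with `K = K(ω₂, lam, β)`. [folklore] -/
theorem partialQ_hamiltonian_sq_le (ω₂ lam β γ : ℝ) : ∃ K : ℝ, 0 ≤ K ∧ ∀ (L : ℕ) (k : Fin L)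
    (x : PhaseSpace L) (m : ℝ), 1 ≤ m → x.1 k ^ 2 ≤ m → (∀ l : Fin L, l.val = k.val + 1 → x.1 l ^ 2 ≤ m) →
    (∀ l : Fin L, k.val = l.val + 1 → x.1 l ^ 2 ≤ m) →
    (partialQ k ((pinnedChain ω₂ lam β γ).hamiltonian L) x) ^ 2 ≤ K * m ^ 3 := by
  refine ⟨?_, ?_, fun L k x m hm hk hs hp => ?_⟩
  rotate_left 2
  · rw [partialQ_hamiltonian_explicit]
    have hC : (∑ l : Fin L, if l.val = k.val + 1 then ((x.1 l - x.1 k) + β * (x.1 l - x.1 k) ^ 3) else 0) ^ 2 ≤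
        (2 * (4 + β ^ 2 * 64)) * m ^ 3 :=
      sq_sum_succ_le k (by positivity) fun l hl => derivV_sq_le hm (hs l hl) hk
    have hD : (∑ l : Fin L, if k.val = l.val + 1 then ((x.1 k - x.1 l) + β * (x.1 k - x.1 l) ^ 3) else 0) ^ 2 ≤
        (2 * (4 + β ^ 2 * 64)) * m ^ 3 :=
      sq_sum_pred_le k (by positivity) fun l hl => derivV_sq_le hm hk (hp l hl)
    exact sq_add_le (sq_sub_le (sq_add_le (sq_mul_le (sq_const_le ω₂ m) (sq_le_pow_one hk))
      (sq_mul_le (sq_const_le lam m) (cube_sq_le hk)) hm (by norm_num) (by norm_num)) hC hm (le_refl 3)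
      (le_refl 3)) hD hm (le_refl 3) (le_refl 3)
  · positivity

/-- **The diagonal Hessian entry is locally quadratic**: `H_kk² ≤ K m²` whenever `m ≥ 1` dominates `q_k²` and
the squares of the neighbouring positions, with `K = K(ω₂, lam, β)`. [folklore] -/
theorem partialQ_partialQ_hamiltonian_sq_le (ω₂ lam β γ : ℝ) : ∃ K : ℝ, 0 ≤ K ∧ ∀ (L : ℕ) (k : Fin L)
    (x : PhaseSpace L) (m : ℝ), 1 ≤ m → x.1 k ^ 2 ≤ m → (∀ l : Fin L, l.val = k.val + 1 → x.1 l ^ 2 ≤ m) →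
    (∀ l : Fin L, k.val = l.val + 1 → x.1 l ^ 2 ≤ m) →
    (partialQ k (partialQ k ((pinnedChain ω₂ lam β γ).hamiltonian L)) x) ^ 2 ≤ K * m ^ 2 := by
  refine ⟨?_, ?_, fun L k x m hm hk hs hp => ?_⟩
  rotate_left 2
  · rw [partialQ_partialQ_hamiltonian, hessPotential_diag]
    have hC : (∑ l : Fin L, if l.val = k.val + 1 then (1 + 3 * β * (x.1 l - x.1 k) ^ 2) else 0) ^ 2 ≤
        (2 * (1 ^ 2 + (3 * β) ^ 2 * (1 * 16))) * m ^ 2 :=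
      sq_sum_succ_le k (by positivity) fun l hl => dderivV_sq_le hm (hs l hl) hk
    have hD : (∑ l : Fin L, if k.val = l.val + 1 then (1 + 3 * β * (x.1 k - x.1 l) ^ 2) else 0) ^ 2 ≤
        (2 * (1 ^ 2 + (3 * β) ^ 2 * (1 * 16))) * m ^ 2 :=
      sq_sum_pred_le k (by positivity) fun l hl => dderivV_sq_le hm hk (hp l hl)
    exact sq_add_le (sq_add_le (sq_add_le (sq_const_le ω₂ m) (sq_mul_le (sq_const_le (3 * lam) m) (sq_sq_le hk))
      hm (by norm_num) (by norm_num)) hC hm (le_refl 2) (le_refl 2)) hD hm (le_refl 2) (le_refl 2)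
  · positivity

/-! ### The bond blocks `R_A`, `R_B` of the Liouvillian of the witness -/

/-- **`R_A² ≤ K m⁴`** on a bond `(i, j)`: `m ≥ 1` dominates `p_j²`, `q_j²` and the squares of the coordinates of the
neighbours of `j`; `K = K(ω₂, lam, β)` (`β ≥ 0`). [folklore] -/
theorem bondRA_sq_le (ω₂ lam γ : ℝ) (hβ : 0 ≤ β) : ∃ K : ℝ, 0 ≤ K ∧ ∀ (L : ℕ) (i j : Fin L) (x : PhaseSpace L)
    (m : ℝ), 1 ≤ m → x.2 j ^ 2 ≤ m → x.1 j ^ 2 ≤ m →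
    (∀ l : Fin L, l.val = j.val + 1 → x.2 l ^ 2 ≤ m) → (∀ l : Fin L, l.val = j.val + 1 → x.1 l ^ 2 ≤ m) →
    (∀ l : Fin L, j.val = l.val + 1 → x.1 l ^ 2 ≤ m) →
    (x.2 j * (x.2 j ^ 2 * (6 * β * (9 * β * (x.1 j - x.1 i) ^ 2 - 1) / (1 + 3 * β * (x.1 j - x.1 i) ^ 2) ^ 3) -
          partialQ j (partialQ j ((pinnedChain ω₂ lam β γ).hamiltonian L)) x * (1 / (1 + 3 * β * (x.1 j - x.1 i) ^ 2)) -
          3 * partialQ j ((pinnedChain ω₂ lam β γ).hamiltonian L) x *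
            (-(6 * β * (x.1 j - x.1 i)) / (1 + 3 * β * (x.1 j - x.1 i) ^ 2) ^ 2)) +
        (∑ k : Fin L, if k.val = j.val + 1 then x.2 k * (1 + 3 * β * (x.1 k - x.1 j) ^ 2) else 0) *
          (1 / (1 + 3 * β * (x.1 j - x.1 i) ^ 2))) ^ 2 ≤ K * m ^ 4 := by
  obtain ⟨KH, hKH0, hKH⟩ := partialQ_hamiltonian_sq_le ω₂ lam β γ
  obtain ⟨KHH, hKHH0, hKHH⟩ := partialQ_partialQ_hamiltonian_sq_le ω₂ lam β γ
  refine ⟨?_, ?_, fun L i j x m hm hpj hqj hps hqs hqp => ?_⟩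
  rotate_left 2
  · have hΦ := sq_le_pow_zero (phi_sq_le_one hβ (x.1 j - x.1 i)) m
    have hD := sq_le_pow_zero (dphi_sq_le hβ (x.1 j - x.1 i)) m
    have hDD := sq_le_pow_zero (ddphi_sq_le hβ (x.1 j - x.1 i)) m
    have hQ := hKH L j x m hm hqj hqs hqp
    have hQQ := hKHH L j x m hm hqj hqs hqp
    have hS : (∑ k : Fin L, if k.val = j.val + 1 then x.2 k * (1 + 3 * β * (x.1 k - x.1 j) ^ 2) else 0) ^ 2 ≤
        (1 * (2 * (1 ^ 2 + (3 * β) ^ 2 * (1 * 16)))) * m ^ (1 + 2) :=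
      sq_sum_succ_le j (by positivity) fun l hl => sq_mul_le (sq_le_pow_one (hps l hl)) (dderivV_sq_le hm (hqs l hl) hqj)
    exact sq_add_le (n := 4) (sq_mul_le (sq_le_pow_one hpj) (sq_sub_le (n := 3) (sq_sub_le (n := 2)
      (sq_mul_le (sq_sq_le hpj) hDD) (sq_mul_le hQQ hΦ) hm (by norm_num) (by norm_num))
      (sq_mul_le (sq_mul_le (sq_const_le 3 m) hQ) hD) hm (by norm_num) (by norm_num))) (sq_mul_le hS hΦ) hm
      (by norm_num) (by norm_num)
  · positivity

/-- **`R_B² ≤ K m⁴`** on a bond `(i, j)`: `m ≥ 1` dominates `p_i²`, `q_i²` and the squares of the coordinates of the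
neighbours of `i`; `K = K(ω₂, lam, β)` (`β ≥ 0`). [folklore] -/
theorem bondRB_sq_le (ω₂ lam γ : ℝ) (hβ : 0 ≤ β) : ∃ K : ℝ, 0 ≤ K ∧ ∀ (L : ℕ) (i j : Fin L) (x : PhaseSpace L)
    (m : ℝ), 1 ≤ m → x.2 i ^ 2 ≤ m → x.1 i ^ 2 ≤ m →
    (∀ l : Fin L, i.val = l.val + 1 → x.2 l ^ 2 ≤ m) → (∀ l : Fin L, i.val = l.val + 1 → x.1 l ^ 2 ≤ m) →
    (∀ l : Fin L, l.val = i.val + 1 → x.1 l ^ 2 ≤ m) →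
    (x.2 i * (-(x.2 i ^ 2 * (6 * β * (9 * β * (x.1 j - x.1 i) ^ 2 - 1) / (1 + 3 * β * (x.1 j - x.1 i) ^ 2) ^ 3)) +
          partialQ i (partialQ i ((pinnedChain ω₂ lam β γ).hamiltonian L)) x * (1 / (1 + 3 * β * (x.1 j - x.1 i) ^ 2)) -
          3 * partialQ i ((pinnedChain ω₂ lam β γ).hamiltonian L) x *
            (-(6 * β * (x.1 j - x.1 i)) / (1 + 3 * β * (x.1 j - x.1 i) ^ 2) ^ 2)) -
        (∑ k : Fin L, if i.val = k.val + 1 then x.2 k * (1 + 3 * β * (x.1 i - x.1 k) ^ 2) else 0) *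
          (1 / (1 + 3 * β * (x.1 j - x.1 i) ^ 2))) ^ 2 ≤ K * m ^ 4 := by
  obtain ⟨KH, hKH0, hKH⟩ := partialQ_hamiltonian_sq_le ω₂ lam β γ
  obtain ⟨KHH, hKHH0, hKHH⟩ := partialQ_partialQ_hamiltonian_sq_le ω₂ lam β γ
  refine ⟨?_, ?_, fun L i j x m hm hpi hqi hpp hqp hqs => ?_⟩
  rotate_left 2
  · have hΦ := sq_le_pow_zero (phi_sq_le_one hβ (x.1 j - x.1 i)) m
    have hD := sq_le_pow_zero (dphi_sq_le hβ (x.1 j - x.1 i)) m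
    have hDD := sq_le_pow_zero (ddphi_sq_le hβ (x.1 j - x.1 i)) m
    have hQ := hKH L i x m hm hqi hqs hqp
    have hQQ := hKHH L i x m hm hqi hqs hqp
    have hS : (∑ k : Fin L, if i.val = k.val + 1 then x.2 k * (1 + 3 * β * (x.1 i - x.1 k) ^ 2) else 0) ^ 2 ≤
        (1 * (2 * (1 ^ 2 + (3 * β) ^ 2 * (1 * 16)))) * m ^ (1 + 2) :=
      sq_sum_pred_le i (by positivity) fun l hl => sq_mul_le (sq_le_pow_one (hpp l hl)) (dderivV_sq_le hm hqi (hqp l hl))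
    exact sq_sub_le (n := 4) (sq_mul_le (sq_le_pow_one hpi) (sq_sub_le (n := 3) (sq_add_le (n := 2)
      (sq_neg_le (sq_mul_le (sq_sq_le hpi) hDD)) (sq_mul_le hQQ hΦ) hm (by norm_num) (by norm_num))
      (sq_mul_le (sq_mul_le (sq_const_le 3 m) hQ) hD) hm (by norm_num) (by norm_num))) (sq_mul_le hS hΦ) hm
      (by norm_num) (by norm_num)
  · positivity

/-! ### Registered helper -/

/-- Registered helper sub-goal `helper_thomsonWitnessPhiBounds` of crux stmt-AtomisticToContinuum-11977 (line
`abel-storage-decay`, stub B `stub_bulkAbelGKPositivity`, part W5b): the three bounded factors of the Thomson witness,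
`|φ| ≤ 1`, `|φ'| ≤ √(3β)`, `|φ''| ≤ 24β` for `β ≥ 0`. [folklore] -/
theorem helper_thomsonWitnessPhiBounds : ∀ (β : ℝ), 0 ≤ β → ∀ r : ℝ, |1 / (1 + 3 * β * r ^ 2)| ≤ 1 ∧ |-(6 * β * r) / (1 + 3 * β * r ^ 2) ^ 2| ≤ Real.sqrt (3 * β) ∧ |6 * β * (9 * β * r ^ 2 - 1) / (1 + 3 * β * r ^ 2) ^ 3| ≤ 24 * β :=
  fun _ hβ r => ⟨abs_phi_le_one hβ r, abs_dphi_le hβ r, abs_ddphi_le hβ r⟩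

end Summit.AtomisticToContinuum.FouriersLaw.Theorems.NoisyFourier.ThomsonWitness.Costs.Xv

end
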